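import Mathlib
import Summits.QuantumFields.QCD.Theorems.PauliWegnerSeaPhaseQuenchedFlavourDecayGramMomentIntegrableMixedFinal
import Summits.QuantumFields.QCD.Theorems.PauliWegnerSeaPhaseQuenchedFlavourDecayStubGramInequality
import Literature.MathematicalPhysics.QuantumFieldTheory.QCDWickMinorMeasurability

/-!
# Stub `stub_minorMomentIntegrable` of line `crossing-split-integrability`
(crux `Summit.QuantumFields.QCD.Theses.PauliWegnerSea.PhaseQuenchedFlavourDecay`, item stmt-QuantumFields-9151)

The INTEGRABILITY conjunct of the minor-form a-priori estimate (Signature B) at every finite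
`(L, β, mq)`: there is a window `s₀ > 0` (the one of `stub_gramMomentIntegrableMixed`) such that for
every `N_f`, every `0 < ε < s₀ / (N_f + 1)`, every torus of side `L ≥ 4`, every `β`, mass vector `mq`,
`r` and index maps `I J : Fin r → QuarkVar N_f L`, the `(1+ε)`-th power of the Wick minor
`‖det (D(U)⁻¹)[I,J]‖` of the Wilson quark propagator is integrable under the phase-quenched measure
`qcdLatticeMeasure L β mq`.

Proof (domination, as in `stub_gramTransfer`).  Put `q := (1+ε)/2`, so `1/2 < q < 1/2 + s₀/(2(N_f+1))`
and `stub_gramMomentIntegrableMixed` gives integrability of `(Re det((G Gᴴ)[I,I]))^q`,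
`G = (diracMatrix U mq)⁻¹`.  Pointwise `0 ≤ ‖det G[I,J]‖^{1+ε} = (‖det G[I,J]‖²)^q ≤ (Re det((G Gᴴ)[I,I]))^q`
by the Gram inequality `stub_gramInequality` and monotonicity of `t ↦ t^q` (`q ≥ 0`); the minor is
measurable (`measurable_det_inv_diracMatrix`), hence so is `‖·‖^{1+ε}` of it; conclude with
`Integrable.mono'`.
-/

noncomputable section

namespace Summit.QuantumFields.QCD.Cruxes.PhaseQuenchedFlavourDecay.CrossingSplitIntegrability

open scoped BigOperators
open MeasureTheory Filter
open Literature.MathematicalPhysics.QuantumFieldTheory Literature.MathematicalPhysics.QuantumLattice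
  Literature.Probability.LatticeModels

/-- Pointwise transfer: `0 ≤ x`, `x² ≤ y`, `0 ≤ p` give `x^p = (x²)^{p/2} ≤ y^{p/2}`. -/
private theorem rpow_le_rpow_half_of_sq_le {x y p : ℝ} (hx : 0 ≤ x) (hxy : x ^ 2 ≤ y)
    (hp : 0 ≤ p) : x ^ p ≤ y ^ (p / 2) := by
  have h2 : x ^ p = (x ^ 2) ^ (p / 2) := by
    rw [← Real.rpow_two, ← Real.rpow_mul hx]
    congr 1
    ring
  rw [h2]
  exact Real.rpow_le_rpow (sq_nonneg x) hxy (by linarith)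

/-- Registered stub `stub_minorMomentIntegrable` of line `crossing-split-integrability` for crux
stmt-QuantumFields-9151 — the integrability conjunct of the minor-form a-priori estimate at every finite
`(L, β, mq)`: with `s₀` the window of `stub_gramMomentIntegrableMixed`, for `0 < ε < s₀/(N_f+1)` the
integrand `‖det (D(U)⁻¹)[I,J]‖^{1+ε}` is `qcdLatticeMeasure L β mq`-integrable (domination by
`(Re det((G Gᴴ)[I,I]))^{(1+ε)/2}` via the Gram inequality, measurability of Wick minors,
`Integrable.mono'`). -/
theorem stub_minorMomentIntegrable :
    ∃ s₀ : ℝ, 0 < s₀ ∧ ∀ (Nf : ℕ) (ε : ℝ), 0 < ε → ε < s₀ / ((Nf : ℝ) + 1) →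
      ∀ (L : ℕ) [NeZero L], 4 ≤ L → ∀ (β : ℝ) (mq : Fin Nf → ℝ) (r : ℕ) (I J : Fin r → QuarkVar Nf L),
        MeasureTheory.Integrable (fun U : GaugeConfig 4 L SU3 =>
          ‖(Matrix.of fun a b : Fin r => (diracMatrix U mq)⁻¹ (quarkEquiv (I a)) (quarkEquiv (J b))).det‖ ^
            (1 + ε)) (qcdLatticeMeasure L β mq) := by
  obtain ⟨s₀, hs₀, hG⟩ := stub_gramMomentIntegrableMixed
  refine ⟨s₀, hs₀, ?_⟩
  intro Nf ε hε hεs L _ hL β mq r I J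
  have hN : (0 : ℝ) < (Nf : ℝ) + 1 := by positivity
  have hq1 : 1 / 2 < (1 + ε) / 2 := by linarith
  have hq2 : (1 + ε) / 2 < 1 / 2 + s₀ / (2 * ((Nf : ℝ) + 1)) := by
    have h : s₀ / (2 * ((Nf : ℝ) + 1)) = s₀ / ((Nf : ℝ) + 1) / 2 := by
      rw [div_div, mul_comm]
    rw [h]
    linarith
  -- integrability of the dominating Gram moment `(Re det((G Gᴴ)[I,I]))^q`, `q = (1+ε)/2`
  have hint := hG Nf ((1 + ε) / 2) hq1 hq2 L hL β mq r I
  refine hint.mono' ?_ (Eventually.of_forall fun U => ?_)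
  · -- measurability of the Wick minor, hence of `‖minor‖^{1+ε}`
    exact ((measurable_det_inv_diracMatrix (S := L) mq (fun a => quarkEquiv (I a))
      (fun b => quarkEquiv (J b))).norm.pow_const _).aestronglyMeasurable
  · -- pointwise `‖ ‖minor‖^{1+ε} ‖ = ‖minor‖^{1+ε} = (‖minor‖²)^q ≤ (Re det Gram)^q`
    exact (Real.norm_of_nonneg (Real.rpow_nonneg (norm_nonneg _) _)).trans_le
      (rpow_le_rpow_half_of_sq_le (norm_nonneg _)
        (stub_gramInequality _ r (diracMatrix U mq)⁻¹ (fun a => quarkEquiv (I a))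
          (fun b => quarkEquiv (J b))) (by linarith))

end Summit.QuantumFields.QCD.Cruxes.PhaseQuenchedFlavourDecay.CrossingSplitIntegrability

end
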